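import Literature.MathematicalPhysics.QuantumLattice.SectorDenomLineBounds
import Literature.Analysis.Calculus.IteratedDerivLeibnizBound
import HarnessLib

/-!
# The sector cutoff `F_{h,ω}χ = σ·D` along lines: `h`-uniform all-order line-derivative bounds without the `γ^{-h}` prefactor

Topic `MathematicalPhysics/QuantumLattice`.  Benfatto–Giuliani–Mastropietro 2006, §2.7 (2.66)–(2.71a): the sectorised
propagators and the modified kernels carry the SECTOR CUTOFFS `F̃_{h,ω}` on their legs, and the product symbols
`F̃_ω F̃_{ω'} g` obey "the same bounds" as `g`; their content is that a smooth sector cutoff has, along any line, the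
derivative bounds of the sector symbol `σ = F_{h,ω}χ/D` WITHOUT its size `γ^{-h}`.  Here this is PROVED for the cutoff
written as `σ · D` (which IS `F_{h,ω}χ`, `sectorSymbol_mul_sectorDenom`):

* `exists_allorder_sectorSymbol_line_le` — one constant for all orders `i ≤ N`: `‖∂ₛⁱ σ(q + s w)‖ ≤ 4ⁿ B ρ(w)ⁱ`,
  `ρ(w) = 4ⁿ|w₀| + 4ⁿ|⟨n, w⃗⟩| + 2ⁿ|⟨τ, w⃗⟩|` (from `SectorSymbolLineBounds`);
* `iteratedDeriv_line_eq_zero_of_not_mem_closure` — off the closure of `{σ ≠ 0}` along the line every line derivative of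
  `σ` and of `σ·D` vanishes; `norm_sectorDenom_le_on_closure`, `abs_grad_dot_le_on_closure` — the denominator bounds of
  `SectorDenomLineBounds` extend to that closure;
* **`exists_allorder_sectorCutoff_line_le`** — for `0 < e₀ ≤ (4+μ)/2` and every `N` there is `B'` with
  `‖∂ₛⁱ (σ·D)(q + s w)‖ ≤ B' ρ(w)ⁱ` for all `i ≤ N`, all scales, sectors, `q, w, s`: Leibniz
  (`norm_iteratedDeriv_mul_le_of_geometric`) with `σ`'s bounds `4ⁿ B ρʲ` and `D`'s bounds `4^{-n} C_D ρʲ` on the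
  closure of the support.

Everything is proved for `-4 < μ < -2-√2`; no definitions, no named facts.

## Sources

G. Benfatto, A. Giuliani, V. Mastropietro, Ann. Henri Poincaré 7 (2006) 809–898, §2.5 Lemma 2.2, §2.7 (2.66)–(2.71a)
(`BenfattoGiulianiMastropietro2006`).
-/

noncomputable section

open Set Filter Literature.Analysis.Calculus
open scoped Real Topology

namespace Literature.MathematicalPhysics.QuantumLattice

/-! ### `σ · D = F_{h,ω} χ` -/

/-- **The sector cutoff is the sector symbol times the denominator**: `σ(p) D(p) = F_{h,ω}(p) χ(p⃗)` (where `F ≠ 0` the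
denominator does not vanish; elsewhere both sides are `0`). [cite: BenfattoGiulianiMastropietro2006, §2.5 (2.49)] -/
theorem sectorSymbol_mul_sectorDenom {e₀ μ : ℝ} (he : 0 < e₀) (n : ℕ) (ω : ℤ) (p : ℝ × (Fin 2 → ℝ)) :
    sectorSymbol e₀ μ n ω p * sectorDenom μ p = ((anisotropicCutoff e₀ μ n ω p * zoneBump p.2 : ℝ) : ℂ) := by
  rw [sectorSymbol]
  by_cases hF : anisotropicCutoff e₀ μ n ω p = 0
  · simp [hF]
  · have hD : sectorDenom μ p ≠ 0 := by
      intro h0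
      have h := (anisotropicCutoff_ne_zero_scale he hF).1
      rw [← norm_sectorDenom μ p, h0, norm_zero] at h
      exact absurd h (not_lt.2 (by positivity))
    exact div_mul_cancel₀ _ hD

/-! ### One constant for all orders -/

section Orders

variable {μ : ℝ} (hμ₁ : -4 < μ) (hμ₂ : μ < -2 - Real.sqrt 2)
include hμ₁ hμ₂

/-- **All-order line bounds of the sector symbol with one constant**: for every `N` there is `B ≥ 0` with
`‖∂ₛⁱ σ(q + s w)‖ ≤ 4ⁿ B ρ(w)ⁱ` for all `i ≤ N`, all scales, sectors, `q, w, s`. [cite: BenfattoGiulianiMastropietro2006, §2.5 Lemma 2.2] -/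
theorem exists_allorder_sectorSymbol_line_le {e₀ : ℝ} (he : 0 < e₀) (he' : e₀ ≤ (4 + μ) / 2) (N : ℕ) :
    ∃ B : ℝ, 0 ≤ B ∧ ∀ (i : ℕ), i ≤ N → ∀ (n : ℕ) (ω : ℕ), ω < sectorCount n → ∀ (q w : ℝ × (Fin 2 → ℝ)) (s : ℝ),
      ‖iteratedDeriv i (fun s : ℝ => sectorSymbol e₀ μ n ω (q + s • w)) s‖ ≤
        (4 : ℝ) ^ n * B * ((4 : ℝ) ^ n * |w.1| +
          (4 : ℝ) ^ n * |fermiNormal μ (((ω : ℝ) + 1 / 2) * sectorWidth n) 0 * w.2 0 +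
            fermiNormal μ (((ω : ℝ) + 1 / 2) * sectorWidth n) 1 * w.2 1| +
          (2 : ℝ) ^ n * |fermiTangent μ (((ω : ℝ) + 1 / 2) * sectorWidth n) 0 * w.2 0 +
            fermiTangent μ (((ω : ℝ) + 1 / 2) * sectorWidth n) 1 * w.2 1|) ^ i := by
  induction N with
  | zero =>
    obtain ⟨B, hB0, hB⟩ := exists_norm_iteratedDeriv_sectorSymbol_line_le hμ₁ hμ₂ he he' 0
    exact ⟨B, hB0, fun i hi n ω hω q w s => by rw [Nat.le_zero.1 hi]; exact hB n ω hω q w s⟩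
  | succ N ih =>
    obtain ⟨B₁, hB₁0, hB₁⟩ := ih
    obtain ⟨B₂, hB₂0, hB₂⟩ := exists_norm_iteratedDeriv_sectorSymbol_line_le hμ₁ hμ₂ he he' (N + 1)
    refine ⟨max B₁ B₂, le_max_of_le_left hB₁0, fun i hi n ω hω q w s => ?_⟩
    rcases Nat.lt_or_ge i (N + 1) with h | h
    · refine (hB₁ i (Nat.lt_succ_iff.1 h) n ω hω q w s).trans ?_
      gcongr
      exact le_max_left _ _
    · have hi' : i = N + 1 := le_antisymm hi h
      subst hi'
      refine (hB₂ n ω hω q w s).trans ?_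
      gcongr
      exact le_max_right _ _

end Orders

/-! ### Vanishing off the closure of the support along a line -/

/-- **Off the closure of the support of a factor, all line derivatives of a product vanish**: if `a(p) = 0` for `p`
outside a set `S` and the line `s ↦ q + s w` passes at `s₀` outside the closure of `S`, then every iterated derivative of
`s ↦ a(q + s w) • b(q + s w)`-type products vanishes at `s₀`; here for `s ↦ a(q + s w) * b(q + s w)`. [folklore] -/
theorem iteratedDeriv_line_mul_eq_zero_of_not_mem_closure {a b : ℝ × (Fin 2 → ℝ) → ℂ} {S : Set (ℝ × (Fin 2 → ℝ))}
    (haS : ∀ p, p ∉ S → a p = 0) (q w : ℝ × (Fin 2 → ℝ)) {s₀ : ℝ} (hs₀ : q + s₀ • w ∉ closure S) (i : ℕ) :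
    iteratedDeriv i (fun s : ℝ => a (q + s • w) * b (q + s • w)) s₀ = 0 := by
  -- the line is continuous, so it stays outside the closed set `closure S` near `s₀`
  have hcont : Continuous fun s : ℝ => q + s • w := by fun_prop
  have hopen : IsOpen ((fun s : ℝ => q + s • w) ⁻¹' (closure S)ᶜ) := (isClosed_closure.isOpen_compl).preimage hcont
  have hmem : s₀ ∈ (fun s : ℝ => q + s • w) ⁻¹' (closure S)ᶜ := hs₀
  have hev : (fun s : ℝ => a (q + s • w) * b (q + s • w)) =ᶠ[𝓝 s₀] fun _ => (0 : ℂ) := by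
    filter_upwards [hopen.mem_nhds hmem] with s hs
    have hs' : q + s • w ∉ S := fun h => hs (subset_closure h)
    rw [haS _ hs', zero_mul]
  rw [(hev.iteratedDeriv i).eq_of_nhds, iteratedDeriv_fun_const_zero]

/-! ### The denominator bounds on the closure of the support -/

section Closure

variable {μ : ℝ} (hμ₁ : -4 < μ) (hμ₂ : μ < -2 - Real.sqrt 2)
include hμ₁ hμ₂

omit hμ₁ hμ₂ in
/-- The sector symbol is supported where the anisotropic cutoff and the zone bump are nonzero. [folklore] -/
theorem anisotropicCutoff_ne_zero_of_sectorSymbol_ne_zero {e₀ μ : ℝ} {n : ℕ} {ω : ℤ} {p : ℝ × (Fin 2 → ℝ)}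
    (h : sectorSymbol e₀ μ n ω p ≠ 0) : anisotropicCutoff e₀ μ n ω p ≠ 0 ∧ zoneBump p.2 ≠ 0 := by
  have hnum : anisotropicCutoff e₀ μ n ω p * zoneBump p.2 ≠ 0 := by
    intro h0; apply h; rw [sectorSymbol, h0, Complex.ofReal_zero, zero_div]
  exact ⟨left_ne_zero_of_mul hnum, right_ne_zero_of_mul hnum⟩

omit hμ₁ hμ₂ in
/-- **`‖D‖ ≤ e₀4^{-n}` on the closure of the support of the sector symbol.** [cite: BenfattoGiulianiMastropietro2006, §2.5 (2.50)] -/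
theorem norm_sectorDenom_le_on_closure {e₀ : ℝ} (he : 0 < e₀) (n : ℕ) (ω : ℤ) {p : ℝ × (Fin 2 → ℝ)}
    (hp : p ∈ closure {p | sectorSymbol e₀ μ n ω p ≠ 0}) : ‖sectorDenom μ p‖ ≤ e₀ * ((4 : ℝ) ^ n)⁻¹ := by
  have hcont : Continuous (sectorDenom μ) := by
    unfold sectorDenom
    exact ((continuous_const.mul (Complex.continuous_ofReal.comp continuous_fst)).neg).add
      (Complex.continuous_ofReal.comp ((continuous_sqDispersion.comp continuous_snd).sub continuous_const))
  have hcl : closure {p : ℝ × (Fin 2 → ℝ) | sectorSymbol e₀ μ n ω p ≠ 0} ⊆ {p | ‖sectorDenom μ p‖ ≤ e₀ * ((4 : ℝ) ^ n)⁻¹} := by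
    refine closure_minimal (fun p hp => ?_) (isClosed_le (continuous_norm.comp hcont) continuous_const)
    have h := (norm_sectorDenom_lt_of_ne_zero he (anisotropicCutoff_ne_zero_of_sectorSymbol_ne_zero hp).1).le
    rwa [zpow_neg, zpow_natCast] at h
  exact hcl hp

/-- **The anisotropic gradient pairing on the closure of the support** (one constant for all scales and sectors):
`|⟨∇ε(p⃗), w⃗⟩| ≤ 4|⟨n, w⃗⟩| + c 2^{-n}|⟨τ, w⃗⟩|` at every `p` in the closure of `{σ_{n,ω} ≠ 0}`.
[cite: BenfattoGiulianiMastropietro2006, §2.5 (2.53)–(2.54)] -/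
theorem exists_abs_grad_dot_le_on_closure {e₀ : ℝ} (he : 0 < e₀) (he' : e₀ ≤ (4 + μ) / 2) :
    ∃ c : ℝ, 0 ≤ c ∧ ∀ {n : ℕ} {ω : ℤ} {p : ℝ × (Fin 2 → ℝ)}, p ∈ closure {p | sectorSymbol e₀ μ n ω p ≠ 0} →
      ∀ w : Fin 2 → ℝ, |2 * Real.sin (p.2 0) * w 0 + 2 * Real.sin (p.2 1) * w 1| ≤
        4 * |fermiNormal μ (((ω : ℝ) + 1 / 2) * sectorWidth n) 0 * w 0 + fermiNormal μ (((ω : ℝ) + 1 / 2) * sectorWidth n) 1 * w 1| +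
          c * ((2 : ℝ) ^ n)⁻¹ *
            |fermiTangent μ (((ω : ℝ) + 1 / 2) * sectorWidth n) 0 * w 0 + fermiTangent μ (((ω : ℝ) + 1 / 2) * sectorWidth n) 1 * w 1| := by
  obtain ⟨c, hc0, hc⟩ := exists_abs_grad_dot_le_on_sector hμ₁ hμ₂ he he'
  refine ⟨c, hc0, fun {n ω p} hp w => ?_⟩
  have hcl : closure {p : ℝ × (Fin 2 → ℝ) | sectorSymbol e₀ μ n ω p ≠ 0} ⊆
      {p : ℝ × (Fin 2 → ℝ) | |2 * Real.sin (p.2 0) * w 0 + 2 * Real.sin (p.2 1) * w 1| ≤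
        4 * |fermiNormal μ (((ω : ℝ) + 1 / 2) * sectorWidth n) 0 * w 0 + fermiNormal μ (((ω : ℝ) + 1 / 2) * sectorWidth n) 1 * w 1| +
          c * ((2 : ℝ) ^ n)⁻¹ *
            |fermiTangent μ (((ω : ℝ) + 1 / 2) * sectorWidth n) 0 * w 0 + fermiTangent μ (((ω : ℝ) + 1 / 2) * sectorWidth n) 1 * w 1|} := by
    refine closure_minimal (fun p hp' => ?_) (isClosed_le (by fun_prop) continuous_const)
    obtain ⟨hF, hχ⟩ := anisotropicCutoff_ne_zero_of_sectorSymbol_ne_zero hp'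
    have hk := norm_le_of_zoneBump_ne_zero hχ
    have hF' : anisotropicCutoff e₀ μ n ω (p.1, p.2) ≠ 0 := hF
    have h := hc hk hF' w
    have e1 : w 0 * fermiNormal μ (((ω : ℝ) + 1 / 2) * sectorWidth n) 0 + w 1 * fermiNormal μ (((ω : ℝ) + 1 / 2) * sectorWidth n) 1 =
        fermiNormal μ (((ω : ℝ) + 1 / 2) * sectorWidth n) 0 * w 0 + fermiNormal μ (((ω : ℝ) + 1 / 2) * sectorWidth n) 1 * w 1 := by ring
    have e2 : w 0 * fermiTangent μ (((ω : ℝ) + 1 / 2) * sectorWidth n) 0 + w 1 * fermiTangent μ (((ω : ℝ) + 1 / 2) * sectorWidth n) 1 =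
        fermiTangent μ (((ω : ℝ) + 1 / 2) * sectorWidth n) 0 * w 0 + fermiTangent μ (((ω : ℝ) + 1 / 2) * sectorWidth n) 1 * w 1 := by ring
    rw [e1, e2, zpow_neg, zpow_natCast] at h
    exact h
  exact hcl hp

/-- The components of `w⃗` are bounded by the frame pairings: `|wⱼ| ≤ |⟨n, w⃗⟩| + |⟨τ, w⃗⟩|`. [folklore] -/
theorem abs_component_le_frame (θ₀ : ℝ) (w : Fin 2 → ℝ) (j : Fin 2) :
    |w j| ≤ |fermiNormal μ θ₀ 0 * w 0 + fermiNormal μ θ₀ 1 * w 1| + |fermiTangent μ θ₀ 0 * w 0 + fermiTangent μ θ₀ 1 * w 1| := by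
  obtain ⟨hn0, hn1⟩ := abs_le_one_of_sq_add_sq (fermiNormal_normSq hμ₁ hμ₂ θ₀)
  obtain ⟨ht0, ht1⟩ := abs_le_one_of_sq_add_sq (fermiTangent_normSq hμ₁ hμ₂ θ₀)
  have key : ∀ (x nj tj : ℝ), |nj| ≤ 1 → |tj| ≤ 1 →
      x = (w 0 * fermiNormal μ θ₀ 0 + w 1 * fermiNormal μ θ₀ 1) * nj + (w 0 * fermiTangent μ θ₀ 0 + w 1 * fermiTangent μ θ₀ 1) * tj →
      |x| ≤ |fermiNormal μ θ₀ 0 * w 0 + fermiNormal μ θ₀ 1 * w 1| + |fermiTangent μ θ₀ 0 * w 0 + fermiTangent μ θ₀ 1 * w 1| := by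
    intro x nj tj hnj htj hx
    have e1 : w 0 * fermiNormal μ θ₀ 0 + w 1 * fermiNormal μ θ₀ 1 = fermiNormal μ θ₀ 0 * w 0 + fermiNormal μ θ₀ 1 * w 1 := by ring
    have e2 : w 0 * fermiTangent μ θ₀ 0 + w 1 * fermiTangent μ θ₀ 1 = fermiTangent μ θ₀ 0 * w 0 + fermiTangent μ θ₀ 1 * w 1 := by
      ring
    rw [hx, e1, e2]
    refine (abs_add_le _ _).trans (add_le_add ?_ ?_)
    · rw [abs_mul]; exact mul_le_of_le_one_right (abs_nonneg _) hnj
    · rw [abs_mul]; exact mul_le_of_le_one_right (abs_nonneg _) htj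
  fin_cases j
  · exact key (w 0) _ _ hn0 ht0 (frame_decomposition_fst hμ₁ hμ₂ θ₀ w)
  · exact key (w 1) _ _ hn1 ht1 (frame_decomposition_snd hμ₁ hμ₂ θ₀ w)

end Closure

/-! ### Real arithmetic of the direction cost `ρ = x t + x a + y b` (`x = 4ⁿ = y²`, `y = 2ⁿ`) -/

/-- The three pairings against `ρ`: `t, a ≤ x⁻¹ρ`, `y⁻¹ b ≤ x⁻¹ ρ`, `a + b ≤ 2y⁻¹ρ`. [folklore] -/
theorem lineCost_components {x y t a b ρ : ℝ} (hy : 1 ≤ y) (hxy : y * y = x) (ht : 0 ≤ t) (ha : 0 ≤ a)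
    (hb : 0 ≤ b) (hρ : ρ = x * t + x * a + y * b) :
    0 ≤ ρ ∧ t ≤ x⁻¹ * ρ ∧ a ≤ x⁻¹ * ρ ∧ y⁻¹ * b ≤ x⁻¹ * ρ ∧ a + b ≤ 2 * (y⁻¹ * ρ) := by
  have hy0 : 0 < y := by linarith
  have hx1 : 1 ≤ x := by nlinarith
  have hx0 : 0 < x := by linarith
  have hyx : y ≤ x := by nlinarith
  have hρ0 : 0 ≤ ρ := by rw [hρ]; positivity
  have h1 : t ≤ x⁻¹ * ρ := by rw [le_inv_mul_iff₀ hx0, hρ]; nlinarith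
  have h2 : a ≤ x⁻¹ * ρ := by rw [le_inv_mul_iff₀ hx0, hρ]; nlinarith
  have h3 : b ≤ y⁻¹ * ρ := by rw [le_inv_mul_iff₀ hy0, hρ]; nlinarith
  have h4 : y⁻¹ * b ≤ x⁻¹ * ρ := by
    calc y⁻¹ * b ≤ y⁻¹ * (y⁻¹ * ρ) := mul_le_mul_of_nonneg_left h3 (by positivity)
      _ = x⁻¹ * ρ := by rw [← mul_assoc, ← mul_inv, hxy]
  have h5 : x⁻¹ * ρ ≤ y⁻¹ * ρ := mul_le_mul_of_nonneg_right (inv_anti₀ hy0 hyx) hρ0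
  exact ⟨hρ0, h1, h2, h4, by linarith⟩

/-- Order `0`: `e₀ x⁻¹ ≤ x⁻¹ (C₀ 2ᴺ)` for `e₀ ≤ C₀`. [folklore] -/
theorem denom_order_zero_arith {x e₀ C₀ : ℝ} (hx : 0 < x) (he : e₀ ≤ C₀) (hC : 0 ≤ C₀) (N : ℕ) :
    e₀ * x⁻¹ ≤ x⁻¹ * (C₀ * 2 ^ N) * (1 : ℝ) := by
  rw [mul_one, mul_comm]
  refine mul_le_mul_of_nonneg_left (he.trans ?_) (by positivity)
  exact le_mul_of_one_le_right hC (one_le_pow₀ (by norm_num))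

/-- Order `1`: `t + G ≤ x⁻¹(C₀2ᴺ)ρ` when `G ≤ 4a + c y⁻¹ b`, `t, a, y⁻¹b ≤ x⁻¹ρ` and `5 + c ≤ C₀`. [folklore] -/
theorem denom_order_one_arith {x y t a b ρ G c C₀ : ℝ} (hc : 0 ≤ c) (hC : 5 + c ≤ C₀) (hu : 0 ≤ x⁻¹ * ρ)
    (ht : t ≤ x⁻¹ * ρ) (ha : a ≤ x⁻¹ * ρ) (hb : y⁻¹ * b ≤ x⁻¹ * ρ) (hG : G ≤ 4 * a + c * y⁻¹ * b) (N : ℕ) :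
    t + G ≤ x⁻¹ * (C₀ * 2 ^ N) * (ρ : ℝ) ^ 1 := by
  have h1 : c * y⁻¹ * b ≤ c * (x⁻¹ * ρ) := by rw [mul_assoc]; exact mul_le_mul_of_nonneg_left hb hc
  have h2 : t + G ≤ (5 + c) * (x⁻¹ * ρ) := by nlinarith
  refine h2.trans ?_
  rw [pow_one, show x⁻¹ * (C₀ * 2 ^ N) * ρ = (C₀ * 2 ^ N) * (x⁻¹ * ρ) by ring]
  refine mul_le_mul_of_nonneg_right (hC.trans ?_) hu
  exact le_mul_of_one_le_right (by linarith) (one_le_pow₀ (by norm_num))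

/-- Orders `j ≥ 2`: `2|w₀|ʲ + 2|w₁|ʲ ≤ x⁻¹ (C₀ 2ᴺ) ρʲ` when `|wₖ| ≤ 2y⁻¹ρ`, `y² = x ≥ y ≥ 1`, `j ≤ N`, `4 ≤ C₀`.
[folklore] -/
theorem denom_order_high_arith {x y ρ w₀ w₁ C₀ : ℝ} {j N : ℕ} (hy : 1 ≤ y) (hxy : y * y = x) (hρ : 0 ≤ ρ)
    (hj : 2 ≤ j) (hjN : j ≤ N) (hC : 4 ≤ C₀) (h0 : |w₀| ≤ 2 * (y⁻¹ * ρ)) (h1 : |w₁| ≤ 2 * (y⁻¹ * ρ)) :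
    2 * |w₀| ^ j + 2 * |w₁| ^ j ≤ x⁻¹ * (C₀ * 2 ^ N) * ρ ^ j := by
  have hy0 : 0 < y := by linarith
  have hx0 : 0 < x := by nlinarith
  have hp0 : |w₀| ^ j ≤ (2 * (y⁻¹ * ρ)) ^ j := pow_le_pow_left₀ (abs_nonneg _) h0 j
  have hp1 : |w₁| ^ j ≤ (2 * (y⁻¹ * ρ)) ^ j := pow_le_pow_left₀ (abs_nonneg _) h1 j
  have hgeo : (y⁻¹) ^ j ≤ x⁻¹ := by
    have hle1 : y⁻¹ ≤ 1 := inv_le_one_of_one_le₀ hy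
    calc (y⁻¹) ^ j ≤ (y⁻¹) ^ 2 := pow_le_pow_of_le_one (by positivity) hle1 hj
      _ = x⁻¹ := by rw [sq, ← mul_inv, hxy]
  have h2j : (2 : ℝ) ^ j ≤ 2 ^ N := pow_le_pow_right₀ (by norm_num) hjN
  have hkey : (2 * (y⁻¹ * ρ)) ^ j ≤ 2 ^ N * x⁻¹ * ρ ^ j := by
    rw [mul_pow, mul_pow]
    have := mul_le_mul h2j (mul_le_mul_of_nonneg_right hgeo (pow_nonneg hρ j)) (by positivity) (by positivity)
    simpa [mul_assoc] using this
  calc 2 * |w₀| ^ j + 2 * |w₁| ^ j ≤ 4 * (2 ^ N * x⁻¹ * ρ ^ j) := by linarith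
    _ = (x⁻¹ * ρ ^ j) * (4 * 2 ^ N) := by ring
    _ ≤ (x⁻¹ * ρ ^ j) * (C₀ * 2 ^ N) := by gcongr
    _ = x⁻¹ * (C₀ * 2 ^ N) * ρ ^ j := by ring

/-- The Leibniz constant: `2ⁱ (xB)(x⁻¹ C₀2ᴺ) r ≤ 4ᴺ B C₀ r` for `i ≤ N`. [folklore] -/
theorem leibniz_constant_arith {x B C₀ r : ℝ} {i N : ℕ} (hx : 0 < x) (hB : 0 ≤ B) (hC : 0 ≤ C₀) (hr : 0 ≤ r)
    (hi : i ≤ N) : 2 ^ i * (x * B) * (x⁻¹ * (C₀ * 2 ^ N)) * r ≤ 4 ^ N * B * C₀ * r := by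
  have h2i : (2 : ℝ) ^ i ≤ 2 ^ N := pow_le_pow_right₀ (by norm_num) hi
  have h4 : (4 : ℝ) ^ N = 2 ^ N * 2 ^ N := by rw [← mul_pow]; norm_num
  calc 2 ^ i * (x * B) * (x⁻¹ * (C₀ * 2 ^ N)) * r = 2 ^ i * 2 ^ N * B * C₀ * r * (x * x⁻¹) := by ring
    _ = 2 ^ i * 2 ^ N * B * C₀ * r := by rw [mul_inv_cancel₀ hx.ne', mul_one]
    _ ≤ 2 ^ N * 2 ^ N * B * C₀ * r := by gcongr
    _ = 4 ^ N * B * C₀ * r := by rw [h4]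

/-! ### The main estimate -/

section Main

variable {μ : ℝ} (hμ₁ : -4 < μ) (hμ₂ : μ < -2 - Real.sqrt 2)
include hμ₁ hμ₂

/-- **All-order line bounds of the sector cutoff `σ·D` with one constant and no `γ^{-h}` prefactor**: for
`0 < e₀ ≤ (4+μ)/2` and every `N` there is `B' ≥ 0` such that for all `i ≤ N`, all scales `n`, sectors `ω < 2^{n+1}`,
and all `q, w, s`,
`‖∂ₛⁱ [σ(q + s w) D(q + s w)]‖ ≤ B' (4ⁿ|w₀| + 4ⁿ|⟨n(θ_{n,ω}), w⃗⟩| + 2ⁿ|⟨τ(θ_{n,ω}), w⃗⟩|)ⁱ`.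
[cite: BenfattoGiulianiMastropietro2006, §2.7 (2.71a)] -/
theorem exists_allorder_sectorCutoff_line_le {e₀ : ℝ} (he : 0 < e₀) (he' : e₀ ≤ (4 + μ) / 2) (N : ℕ) :
    ∃ B' : ℝ, 0 ≤ B' ∧ ∀ (i : ℕ), i ≤ N → ∀ (n : ℕ) (ω : ℕ), ω < sectorCount n → ∀ (q w : ℝ × (Fin 2 → ℝ)) (s : ℝ),
      ‖iteratedDeriv i (fun s : ℝ => sectorSymbol e₀ μ n ω (q + s • w) * sectorDenom μ (q + s • w)) s‖ ≤
        B' * ((4 : ℝ) ^ n * |w.1| +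
          (4 : ℝ) ^ n * |fermiNormal μ (((ω : ℝ) + 1 / 2) * sectorWidth n) 0 * w.2 0 +
            fermiNormal μ (((ω : ℝ) + 1 / 2) * sectorWidth n) 1 * w.2 1| +
          (2 : ℝ) ^ n * |fermiTangent μ (((ω : ℝ) + 1 / 2) * sectorWidth n) 0 * w.2 0 +
            fermiTangent μ (((ω : ℝ) + 1 / 2) * sectorWidth n) 1 * w.2 1|) ^ i := by
  obtain ⟨B, hB0, hB⟩ := exists_allorder_sectorSymbol_line_le hμ₁ hμ₂ he he' N
  obtain ⟨c, hc0, hc⟩ := exists_abs_grad_dot_le_on_closure hμ₁ hμ₂ he he'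
  -- the denominator constant `C₀ = e₀ + 9 + c` (`e₀, 5 + c, 4 ≤ C₀`)
  have hC0 : 0 ≤ e₀ + 9 + c := by positivity
  refine ⟨4 ^ N * B * (e₀ + 9 + c), by positivity, fun i hi n ω hω q w s => ?_⟩
  -- the direction cost
  obtain ⟨ρ, hρ⟩ : ∃ ρ : ℝ, ρ = (4 : ℝ) ^ n * |w.1| +
      (4 : ℝ) ^ n * |fermiNormal μ (((ω : ℝ) + 1 / 2) * sectorWidth n) 0 * w.2 0 +
        fermiNormal μ (((ω : ℝ) + 1 / 2) * sectorWidth n) 1 * w.2 1| +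
      (2 : ℝ) ^ n * |fermiTangent μ (((ω : ℝ) + 1 / 2) * sectorWidth n) 0 * w.2 0 +
        fermiTangent μ (((ω : ℝ) + 1 / 2) * sectorWidth n) 1 * w.2 1| := ⟨_, rfl⟩
  rw [← hρ]
  have hx : (0 : ℝ) < 4 ^ n := by positivity
  have hy1 : (1 : ℝ) ≤ 2 ^ n := one_le_pow₀ (by norm_num)
  have hxy : (2 : ℝ) ^ n * 2 ^ n = 4 ^ n := by rw [← mul_pow]; norm_num
  obtain ⟨hρ0, hw0, hnw, htw, hsum⟩ := lineCost_components hy1 hxy (abs_nonneg _) (abs_nonneg _) (abs_nonneg _) hρ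
  by_cases hcl : q + s • w ∈ closure {p : ℝ × (Fin 2 → ℝ) | sectorSymbol e₀ μ n (ω : ℤ) p ≠ 0}
  · -- Leibniz on the closure of the support
    have hσ : ContDiff ℝ i fun s : ℝ => sectorSymbol e₀ μ n (ω : ℤ) (q + s • w) :=
      contDiff_lineRestriction (contDiff_sectorSymbol hμ₁ hμ₂ he he' n (ω : ℤ)) q w
    have hDs : ContDiff ℝ i fun s : ℝ => sectorDenom μ (q + s • w) := by
      rw [funext fun s => sectorDenom_line_eq μ q w s]; fun_prop
    -- `σ`: `‖∂ʲσ‖ ≤ (4ⁿB) ρʲ`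
    have hA : ∀ j ≤ i, ‖iteratedDeriv j (fun s : ℝ => sectorSymbol e₀ μ n (ω : ℤ) (q + s • w)) s‖ ≤ (4 : ℝ) ^ n * B * ρ ^ j := by
      intro j hj
      have h := hB j (hj.trans hi) n ω hω q w s
      rwa [← hρ] at h
    -- `D`: `‖∂ʲD‖ ≤ (4^{-n} C₀ 2ᴺ) ρʲ`
    have hwj : ∀ j : Fin 2, |w.2 j| ≤ 2 * (((2 : ℝ) ^ n)⁻¹ * ρ) := fun j =>
      (abs_component_le_frame hμ₁ hμ₂ (((ω : ℝ) + 1 / 2) * sectorWidth n) w.2 j).trans hsum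
    have hBd : ∀ j ≤ i, ‖iteratedDeriv j (fun s : ℝ => sectorDenom μ (q + s • w)) s‖ ≤
        ((4 : ℝ) ^ n)⁻¹ * ((e₀ + 9 + c) * 2 ^ N) * ρ ^ j := by
      intro j hji
      rcases Nat.lt_or_ge j 2 with hj2 | hj2
      · interval_cases j
        · -- order 0: `‖D‖ ≤ e₀4^{-n}`
          rw [iteratedDeriv_zero, pow_zero]
          exact (norm_sectorDenom_le_on_closure he n (ω : ℤ) hcl).trans
            (denom_order_zero_arith hx (by linarith) hC0 N)
        · -- order 1: `|w₀| + |⟨∇ε, w⟩| ≤ (5 + c) 4^{-n} ρ`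
          refine (norm_deriv_sectorDenom_line_le μ q w s).trans ?_
          have hg := hc hcl w.2
          simp only [Prod.snd_add, Prod.smul_snd, Pi.add_apply, Pi.smul_apply, smul_eq_mul, Int.cast_natCast] at hg
          exact denom_order_one_arith hc0 (by linarith) (by positivity) hw0 hnw htw hg N
      · -- order ≥ 2
        exact (norm_iteratedDeriv_sectorDenom_line_le μ q w s hj2).trans
          (denom_order_high_arith hy1 hxy hρ0 hj2 (hji.trans hi) (by linarith) (hwj 0) (hwj 1))
    exact (norm_iteratedDeriv_mul_le_of_geometric hσ hDs s hρ0 hA hBd).trans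
      (leibniz_constant_arith hx hB0 hC0 (pow_nonneg hρ0 i) hi)
  · -- off the closure of the support everything vanishes
    rw [iteratedDeriv_line_mul_eq_zero_of_not_mem_closure (S := {p | sectorSymbol e₀ μ n (ω : ℤ) p ≠ 0})
      (fun p hp => by simpa using hp) q w hcl i, norm_zero]
    positivity

end Main

end Literature.MathematicalPhysics.QuantumLattice
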